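import Mathlib
import HarnessLib
import Summits.HubbardSuperconductivity.HubbardSuperconductivity.Theses.WeakCouplingBCS
import Summits.HubbardSuperconductivity.HubbardSuperconductivity.Theorems.WeakCouplingBCSWcbcsBcsConstructionFreeLevelCountsOuter
import Summits.HubbardSuperconductivity.HubbardSuperconductivity.Theorems.WeakCouplingBCSWcbcsBcsConstructionDensityInsideUnitWindow
import Summits.HubbardSuperconductivity.HubbardSuperconductivity.Theorems.WeakCouplingBCSWcbcsBcsConstructionAeDensityMatching

/-!
# Crux `WcbcsBcsConstruction` (stmt-HubbardSuperconductivity-2010): THIN SUFFICIENCY — the summit from crux 2 and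
# `d`-wave order on a `μ`-sub-interval at arbitrarily small `U`; density matching for free

Lead c4 of line `ladder-scale-certified-chain` (prover-line-stmt-HubbardSuperconductivity-2010-c4-0), 2026-08-17, cycle 1.
Write `n_L(U,μ) = Re ω₀[hubbardTorusWith 2 (L+1) 1 U μ](N)/(L+1)²` for the tracial grand-canonical ground-state density of the 2D
Hubbard torus and `m(U,μ) = dWaveOrderParameter U μ` for the Koma–Tasaki `d_{x²-y²}` order parameter (`L → ∞` first, then `h ↓ 0`).

The typed crux asks for ONE doping `δ ∈ (0,1/2)`, uniform over a weak-coupling window `U ∈ (0,U₀)`, a density-matched `μ(U)` and the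
rate `e^{-C/U²} ≤ m(U,μ(U))`.  The registered line needs, besides the constructive programme (M) (order floor uniform on a `μ`-window),
the research stub (D1a) "no density jump anywhere on `[-4/5,-7/20]` for all small `U`" — only to place ONE `U`-uniform `δ`.  But the
route's deciding theorem `WeakCouplingBCS.closes` instantiates a SINGLE coupling (`U := min(U₀,U₁)/2`): the summit
`∃ U > 0 ∃ δ ∈ (0,1/2), HasDWavePairFieldLROAt U δ` lets `δ` depend on `U`.  With that freedom density matching is FREE:

* (T1) `stub_freeLevelCountsOuter` (p143400), (T2) `stub_densityInsideUnitWindow` (p142920), (T3) `stub_aeDensityMatching` (p142962)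
  — all LANDED: the limiting grand-canonical energy density `e(U,·)` exists (p76736), is antitone, hence differentiable at almost every
  `μ`; Griffiths' lemma gives `n_L(U,μ) → -∂_μ e(U,μ)` there; certified free level counts put that density in `[11/20, 19/20] ⊂ (1/2,1)`
  on the whole window `[-21/25, -7/20]` once `U ≤ 1/500`.  Hence EVERY open `μ`-interval of the window contains a density-matched `μ`
  with `δ ∈ (0, 1/2)`.

This file composes them (sorry-free, standard axioms) into:

* `hubbardSuperconductivity_of_wcbcsSsbToTorusLRO_of_thinOrder` — crux 2 `WcbcsSsbToTorusLRO` and THIN ORDER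
  (`∀ U₁ > 0 ∃ U ∈ (0,U₁) ∃ -21/25 ≤ a < b ≤ -7/20 ∀ μ ∈ (a,b), HasDWaveOrder U μ`: no rate, no `U`-uniformity, no density clause) imply
  the SUMMIT `HubbardSuperconductivity`;
* `hubbardSuperconductivity_of_wcbcsSsbToTorusLRO_of_windowFloor` — in particular crux 2 and the promoted stub (M) ALONE (an order floor
  uniform on `[-21/25,-7/20]`, WITHOUT the Kohn–Luttinger input (K1) as a logical hypothesis and WITHOUT (D1a)) imply the summit;
* `wcbcs_thinCrux_of_wcbcsBcsConstruction`, `wcbcs_thinCrux_of_thinOrder`, `hubbardSuperconductivity_of_wcbcsSsbToTorusLRO_of_thinCrux` —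
  the THIN CRUX `∀ U₁ > 0 ∃ U ∈ (0,U₁) ∃ δ ∈ (0,1/2) ∃ μ, n_L(U,μ) → 1-δ ∧ HasDWaveOrder U μ` is implied by the typed crux and by thin
  order, and with crux 2 gives the summit in five lines (the thin analogue of `closes`).

RECOMMENDATION (for the planner; provers do not restate items): restate crux 4 as the thin crux (strictly weaker than the typed one,
same deciding shape `crux 2 → thin crux → HubbardSuperconductivity`), or file THIN ORDER as the crux; either way (D1a), the `U`-uniform
`δ` and the `e^{-C/U²}` rate leave the critical path and the open content is exactly "d-wave symmetry breaking on some `μ`-interval at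
arbitrarily weak repulsion" — the Kohn–Luttinger/BCS programme in its minimal dress.  Nothing here proves that.
References: T. Koma, H. Tasaki, J. Stat. Phys. 76 (1994) 745, §1 (order parameter); R. B. Griffiths, J. Math. Phys. 5 (1964) 1215;
S. Raghu, S. A. Kivelson, D. J. Scalapino, Phys. Rev. B 81 (2010) 224505, §III (where `d_{x²-y²}` is expected).
-/

noncomputable section

-- the tree's namespace `Summit.<Summit>.<Problem>.Theorems` repeats the summit name by design (D-0017)
set_option linter.dupNamespace false

namespace Summit.HubbardSuperconductivity.HubbardSuperconductivity.Theorems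

open Literature.MathematicalPhysics.QuantumLattice Literature.Probability.LatticeModels Filter
open Summit.HubbardSuperconductivity.HubbardSuperconductivity.Theses.WeakCouplingBCS
open scoped Topology

/-- **An order floor uniform on the window gives thin order**: if `e^{-C/U²} ≤ m(U,μ)` for every `U ∈ (0,U₀)` and every
`μ ∈ [-21/25, -7/20]`, then for every `U₁ > 0` the coupling `U := min U₀ U₁ / 2` has `HasDWaveOrder U μ` on the whole open window.
[cite: KomaTasaki1994, §1] -/
theorem wcbcs_thinOrder_of_windowFloor
    (hM : ∃ U₀ C : ℝ, 0 < U₀ ∧ 0 < C ∧ ∀ U ∈ Set.Ioo (0:ℝ) U₀, ∀ μ ∈ Set.Icc (-(21:ℝ) / 25) (-(7:ℝ) / 20),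
      Real.exp (-C / U ^ 2) ≤ dWaveOrderParameter U μ) :
    ∀ U₁ : ℝ, 0 < U₁ → ∃ U ∈ Set.Ioo (0:ℝ) U₁, ∃ a b : ℝ, -(21:ℝ) / 25 ≤ a ∧ a < b ∧ b ≤ -(7:ℝ) / 20 ∧
      ∀ μ ∈ Set.Ioo a b, HasDWaveOrder U μ := by
  intro U₁ hU₁
  obtain ⟨U₀, C, hU₀, -, h⟩ := hM
  have hpos : (0:ℝ) < min U₀ U₁ / 2 := half_pos (lt_min hU₀ hU₁)
  have hlt : min U₀ U₁ / 2 < min U₀ U₁ := half_lt_self (lt_min hU₀ hU₁)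
  refine ⟨min U₀ U₁ / 2, ⟨hpos, lt_of_lt_of_le hlt (min_le_right _ _)⟩, -(21:ℝ) / 25, -(7:ℝ) / 20,
    le_rfl, by norm_num, le_rfl, fun μ hμ => ?_⟩
  exact (hasDWaveOrder_iff _ _).2 (lt_of_lt_of_le (Real.exp_pos _)
    (h _ ⟨hpos, lt_of_lt_of_le hlt (min_le_left _ _)⟩ μ ⟨hμ.1.le, hμ.2.le⟩))

/-- **Thin order gives the thin crux** (density matching for free): for every `U₁ > 0` there are `U ∈ (0,U₁)`, `δ ∈ (0,1/2)` and `μ`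
with `n_L(U,μ) → 1 - δ` and `HasDWaveOrder U μ`.  Take `U₃` from (T3) (`stub_aeDensityMatching`, fed by (T2) `stub_densityInsideUnitWindow`
and (T1) `stub_freeLevelCountsOuter`), thin order below `min U₁ U₃`, and a density-matched `μ` inside its interval of order.
[cite: KomaTasaki1994, §1] -/
theorem wcbcs_thinCrux_of_thinOrder
    (hthin : ∀ U₁ : ℝ, 0 < U₁ → ∃ U ∈ Set.Ioo (0:ℝ) U₁, ∃ a b : ℝ, -(21:ℝ) / 25 ≤ a ∧ a < b ∧ b ≤ -(7:ℝ) / 20 ∧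
      ∀ μ ∈ Set.Ioo a b, HasDWaveOrder U μ) :
    ∀ U₁ : ℝ, 0 < U₁ → ∃ U ∈ Set.Ioo (0:ℝ) U₁, ∃ δ ∈ Set.Ioo (0:ℝ) (1 / 2), ∃ μ : ℝ,
      Tendsto (fun L : ℕ => ((hubbardTorusWith 2 (L + 1) 1 U μ).groundStateFunctional
        totalNumber).re / ((L + 1 : ℕ) : ℝ) ^ 2) atTop (𝓝 (1 - δ)) ∧ HasDWaveOrder U μ := by
  intro U₁ hU₁
  obtain ⟨U₃, hU₃, hT3⟩ := stub_aeDensityMatching (stub_densityInsideUnitWindow stub_freeLevelCountsOuter)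
  obtain ⟨U, hU, a, b, ha, hab, hb, hord⟩ := hthin (min U₁ U₃) (lt_min hU₁ hU₃)
  have hUU₃ : U ∈ Set.Icc (0:ℝ) U₃ := ⟨hU.1.le, (lt_of_lt_of_le hU.2 (min_le_right _ _)).le⟩
  obtain ⟨μ, hμ, δ, hδ, hdens⟩ := hT3 U hUU₃ a b ha hab hb
  exact ⟨U, ⟨hU.1, lt_of_lt_of_le hU.2 (min_le_left _ _)⟩, δ, hδ, μ, hdens, hord μ hμ⟩

/-- **The typed crux gives the thin crux** (so the thin crux is a WEAKENING of crux 4: at `U := min U₀ U₁ / 2` use the crux's own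
density-matched `μ` and `e^{-C/U²} > 0`). [cite: KomaTasaki1994, §1] -/
theorem wcbcs_thinCrux_of_wcbcsBcsConstruction (h4 : WcbcsBcsConstruction) :
    ∀ U₁ : ℝ, 0 < U₁ → ∃ U ∈ Set.Ioo (0:ℝ) U₁, ∃ δ ∈ Set.Ioo (0:ℝ) (1 / 2), ∃ μ : ℝ,
      Tendsto (fun L : ℕ => ((hubbardTorusWith 2 (L + 1) 1 U μ).groundStateFunctional
        totalNumber).re / ((L + 1 : ℕ) : ℝ) ^ 2) atTop (𝓝 (1 - δ)) ∧ HasDWaveOrder U μ := by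
  intro U₁ hU₁
  obtain ⟨δ, hδ, U₀, hU₀, C, -, h⟩ := h4
  have hpos : (0:ℝ) < min U₀ U₁ / 2 := half_pos (lt_min hU₀ hU₁)
  have hlt : min U₀ U₁ / 2 < min U₀ U₁ := half_lt_self (lt_min hU₀ hU₁)
  obtain ⟨μ, hd, hm⟩ := h _ ⟨hpos, lt_of_lt_of_le hlt (min_le_left _ _)⟩
  exact ⟨_, ⟨hpos, lt_of_lt_of_le hlt (min_le_right _ _)⟩, δ, hδ, μ, hd,
    (hasDWaveOrder_iff _ _).2 (lt_of_lt_of_le (Real.exp_pos _) hm)⟩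

/-- **The thin crux and crux 2 give the summit** — the thin analogue of `WeakCouplingBCS.closes`: crux 2's window `U₁`, the thin
crux below it, and the summit is `⟨U, δ, HasDWavePairFieldLROAt U δ⟩` (`Iff.rfl`). [cite: KomaTasaki1994, §1] -/
theorem hubbardSuperconductivity_of_wcbcsSsbToTorusLRO_of_thinCrux (h2 : WcbcsSsbToTorusLRO)
    (hthin : ∀ U₁ : ℝ, 0 < U₁ → ∃ U ∈ Set.Ioo (0:ℝ) U₁, ∃ δ ∈ Set.Ioo (0:ℝ) (1 / 2), ∃ μ : ℝ,
      Tendsto (fun L : ℕ => ((hubbardTorusWith 2 (L + 1) 1 U μ).groundStateFunctional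
        totalNumber).re / ((L + 1 : ℕ) : ℝ) ^ 2) atTop (𝓝 (1 - δ)) ∧ HasDWaveOrder U μ) :
    _root_.HubbardSuperconductivity := by
  obtain ⟨U₁, hU₁, hssb⟩ := h2
  obtain ⟨U, hU, δ, hδ, μ, hdens, hord⟩ := hthin U₁ hU₁
  exact ⟨U, hU.1, δ, hδ, hssb U hU δ hδ μ hdens hord⟩

/-- **THIN SUFFICIENCY.** Crux 2 `WcbcsSsbToTorusLRO` and thin `d`-wave order — for every `U₁ > 0` some `U ∈ (0,U₁)` and some
sub-interval `(a,b)` of `[-21/25, -7/20]` with `HasDWaveOrder U μ` for all `μ ∈ (a,b)` — imply the summit `HubbardSuperconductivity`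
(density matching by (T1)–(T3), then crux 2). [cite: KomaTasaki1994, §1] -/
theorem hubbardSuperconductivity_of_wcbcsSsbToTorusLRO_of_thinOrder (h2 : WcbcsSsbToTorusLRO)
    (hthin : ∀ U₁ : ℝ, 0 < U₁ → ∃ U ∈ Set.Ioo (0:ℝ) U₁, ∃ a b : ℝ, -(21:ℝ) / 25 ≤ a ∧ a < b ∧ b ≤ -(7:ℝ) / 20 ∧
      ∀ μ ∈ Set.Ioo a b, HasDWaveOrder U μ) :
    _root_.HubbardSuperconductivity :=
  hubbardSuperconductivity_of_wcbcsSsbToTorusLRO_of_thinCrux h2 (wcbcs_thinCrux_of_thinOrder hthin)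

/-- **Crux 2 and the promoted stub (M) alone give the summit**: an order floor `e^{-C/U²} ≤ m(U,μ)` uniform on `U ∈ (0,U₀)`,
`μ ∈ [-21/25, -7/20]` (the conclusion of the line's registered stub `stub_dWaveOrderFloorOnWindow`, here WITHOUT its Kohn–Luttinger
antecedent (K1) and WITHOUT the no-density-jump stub (D1a)) implies, with `WcbcsSsbToTorusLRO`, the summit. [cite: KomaTasaki1994, §1] -/
theorem hubbardSuperconductivity_of_wcbcsSsbToTorusLRO_of_windowFloor (h2 : WcbcsSsbToTorusLRO)
    (hM : ∃ U₀ C : ℝ, 0 < U₀ ∧ 0 < C ∧ ∀ U ∈ Set.Ioo (0:ℝ) U₀, ∀ μ ∈ Set.Icc (-(21:ℝ) / 25) (-(7:ℝ) / 20),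
      Real.exp (-C / U ^ 2) ≤ dWaveOrderParameter U μ) :
    _root_.HubbardSuperconductivity :=
  hubbardSuperconductivity_of_wcbcsSsbToTorusLRO_of_thinOrder h2 (wcbcs_thinOrder_of_windowFloor hM)

/-- **Registered form of thin sufficiency** (stub `stub_summitOfThinOrder` of crux stmt-HubbardSuperconductivity-2010, line
`ladder-scale-certified-chain`): crux 2 → thin `d`-wave order on a sub-interval of `[-21/25, -7/20]` at arbitrarily small `U` → the
summit. [cite: KomaTasaki1994, §1] -/
theorem stub_summitOfThinOrder : Summit.HubbardSuperconductivity.HubbardSuperconductivity.Theses.WeakCouplingBCS.WcbcsSsbToTorusLRO → (∀ U₁ : ℝ, 0 < U₁ → ∃ U ∈ Set.Ioo (0:ℝ) U₁, ∃ a b : ℝ, -(21:ℝ) / 25 ≤ a ∧ a < b ∧ b ≤ -(7:ℝ) / 20 ∧ ∀ μ ∈ Set.Ioo a b, HasDWaveOrder U μ) → _root_.HubbardSuperconductivity :=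
  fun h2 hthin => hubbardSuperconductivity_of_wcbcsSsbToTorusLRO_of_thinOrder h2 hthin

end Summit.HubbardSuperconductivity.HubbardSuperconductivity.Theorems

end
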